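import Summits.Ventures.HodgeRepro2.T5HaarHeckeAction
import Summits.Ventures.HodgeRepro2.T5HeckeConvolutionAlgebra

/-!
# The Hecke action as a Haar integral, for a general element of `H(G, K)`

Kernel annex of the Tier-5 record (blind lane).  `T5HaarHeckeAction` matched the printed
`π(1_{KgK}) v = ∫_G 1_{KgK}(y) π(y) v dμ(y)` with the Haar-measure-free operator `T_g` of
`T5HeckeDoubleCoset`.  This file does the same for a GENERAL element of `H(G, K)`: every
`T ∈ H(G, K) = End_G(k[G/K])` is a finite `k`-linear combination of the `T_g`, its function on `G`
is `f_T := (T δ_K) ∘ mk` (bi-`K`-invariant, finitely many double cosets), and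

* `integral_coeff_smul` — `∫_G t(yK) • π(y) v dμ = μ.real(K) • Σ_{q ∈ supp t} t(q) • π(x_q) v`
  for every `t ∈ ℂ[G/K]` and `v ∈ π^K` (the integrand factors through `G ⧸ K`;
  `T5HaarHeckeAction.integral_comp_mk'`), the right-hand side being Frobenius reciprocity's
  `orbitLinear` of `T5HeckePermutationModule` (`orbitLinear_eq_sum`);
* `integral_apply_single_one_smul` — `π(f_T) v = μ.real(K) • (T • v)`, and
  `integral_apply_single_one_smul_of_measure_eq_one` — `= T • v` when `vol(K) = 1`:
  the printed `π(f) v := ∫_G f(y) π(y) v dμ(y)` IS the Hecke action of `T5HeckePermutationModule`;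
* `integral_haarConv_smul_of_measure_eq_one` — `π(f_S ⋆ f_T) v = S • (T • v) = (T S) • v`
  (`vol(K) = 1`; the Haar convolution of `T5HaarCosetIntegral`), i.e. `π(f₁ ∗ f₂) = π(f₁) π(f₂)`.

No continuity of `π` is assumed (the integrands are finite sums of indicator functions of cosets).
What stays prose: the printed theorems.
-/

namespace Summit.Ventures.HodgeRepro2.T5HaarHeckeActionGeneral

open MeasureTheory T5HeckePermutationModule T5HeckeConvolution T5HaarCosetIntegral
  T5HaarHeckeAction LevelPositivity

variable {G : Type*} [Group G] [MeasurableSpace G] [MeasurableMul G]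
  {E : Type*} [NormedAddCommGroup E] [NormedSpace ℂ E] [CompleteSpace E]
  (μ : Measure G) [μ.IsMulLeftInvariant] (ρ : Representation ℂ G E) {K : Subgroup G}

omit [MeasurableSpace G] [MeasurableMul G] [CompleteSpace E] in
/-- Frobenius reciprocity's `orbitLinear` is the finite linear combination
`t ↦ Σ_q t(q) • π(x_q) v`. -/
theorem orbitLinear_eq_sum (v : E) (hv : v ∈ invariants ρ K) (t : MonoidAlgebra ℂ (G ⧸ K)) :
    orbitLinear ρ v hv t = t.coeff.sum fun q c => c • orbitMap ρ v hv q := by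
  simp only [orbitLinear, LinearMap.comp_apply, LinearEquiv.coe_coe,
    MonoidAlgebra.coeffLinearEquiv_apply, Finsupp.linearCombination_apply]

omit [MeasurableSpace G] [MeasurableMul G] [CompleteSpace E] in
/-- For `v ∈ π^K` the integrand `t(yK) • π(y) v` factors through `G ⧸ K`. -/
theorem coeff_smul_apply_eq (v : E) (hv : v ∈ invariants ρ K) (t : MonoidAlgebra ℂ (G ⧸ K)) :
    (fun y : G => t.coeff (y : G ⧸ K) • ρ y v) =
      fun y : G => (fun q : G ⧸ K => t.coeff q • orbitMap ρ v hv q) (y : G ⧸ K) := by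
  funext y
  simp only [orbitMap_mk]

/-- `∫_G t(yK) • π(y) v dμ(y) = μ.real(K) • Σ_q t(q) • π(x_q) v` for `v ∈ π^K`
(`K` measurable, `μ(K) < ∞`). -/
theorem integral_coeff_smul (hKm : MeasurableSet (K : Set G)) (hKfin : μ (K : Set G) ≠ ⊤)
    (t : MonoidAlgebra ℂ (G ⧸ K)) {v : E} (hv : v ∈ invariants ρ K) :
    ∫ y, t.coeff (y : G ⧸ K) • ρ y v ∂μ = μ.real (K : Set G) • orbitLinear ρ v hv t := by
  rw [coeff_smul_apply_eq ρ v hv t,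
    integral_comp_mk' μ hKm hKfin (fun q : G ⧸ K => t.coeff q • orbitMap ρ v hv q)
      (S := t.coeff.support) ?_, orbitLinear_eq_sum, Finsupp.sum]
  intro q hq
  rw [Function.mem_support] at hq
  rw [Finset.mem_coe, Finsupp.mem_support_iff]
  intro h0
  exact hq (by rw [h0, zero_smul])

/-- `π(f_t) v = μ.real(K) • (T_t • v)` for `t ∈ ℂ[G/K]^K` and `T_t ∈ H(G, K)` the element with
`T_t δ_K = t` (`heckeAlgebraEquivInvariants.symm`). -/
theorem integral_coeff_smul_eq_heckeSMul (hKm : MeasurableSet (K : Set G))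
    (hKfin : μ (K : Set G) ≠ ⊤) {t : MonoidAlgebra ℂ (G ⧸ K)}
    (ht : t ∈ invariants (Representation.ofMulAction ℂ G (G ⧸ K)) K) (v : invariants ρ K) :
    ∫ y, t.coeff (y : G ⧸ K) • ρ y (v : E) ∂μ =
      μ.real (K : Set G) • (heckeSMul ρ (heckeAlgebraEquivInvariants.symm ⟨t, ht⟩) v : E) := by
  rw [integral_coeff_smul μ ρ hKm hKfin t v.2, heckeSMul_coe,
    T5HeckeConvolutionAlgebra.coe_heckeAlgebraEquivInvariants_symm_apply_single_one]

/-- **The Hecke action of a general `T ∈ H(G, K)` as a Haar integral**: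
`∫_G f_T(y) • π(y) v dμ(y) = μ.real(K) • (T • v)`, `f_T := (T δ_K) ∘ mk`. -/
theorem integral_apply_single_one_smul (hKm : MeasurableSet (K : Set G))
    (hKfin : μ (K : Set G) ≠ ⊤) (T : heckeAlgebra ℂ K) (v : invariants ρ K) :
    ∫ y, ((T : Module.End ℂ (MonoidAlgebra ℂ (G ⧸ K)))
        (MonoidAlgebra.single ((1 : G) : G ⧸ K) 1)).coeff (y : G ⧸ K) • ρ y (v : E) ∂μ =
      μ.real (K : Set G) • (heckeSMul ρ T v : E) := by
  rw [integral_coeff_smul μ ρ hKm hKfin _ v.2, heckeSMul_coe]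

/-- With `vol(K) = 1`: `π(f_T) v = T • v` — the printed `π(f)` IS the Hecke action. -/
theorem integral_apply_single_one_smul_of_measure_eq_one (hKm : MeasurableSet (K : Set G))
    (h1 : μ (K : Set G) = 1) (T : heckeAlgebra ℂ K) (v : invariants ρ K) :
    ∫ y, ((T : Module.End ℂ (MonoidAlgebra ℂ (G ⧸ K)))
        (MonoidAlgebra.single ((1 : G) : G ⧸ K) 1)).coeff (y : G ⧸ K) • ρ y (v : E) ∂μ =
      (heckeSMul ρ T v : E) := by
  rw [integral_apply_single_one_smul μ ρ hKm (by rw [h1]; exact ENNReal.one_ne_top) T v,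
    measureReal_def, h1, ENNReal.toReal_one, one_smul]

/-- **`π(f₁ ∗ f₂) = π(f₁) π(f₂)`** with `vol(K) = 1`: for `f_S ⋆ f_T` the Haar convolution of
`T5HaarCosetIntegral` (`(f₁ ⋆ f₂)(x) = ∫ f₁(y) f₂(y⁻¹x) dμ(y)`),
`∫_G (f_S ⋆ f_T)(x) • π(x) v dμ(x) = S • (T • v) = (T S) • v`. -/
theorem integral_haarConv_smul_of_measure_eq_one (hKm : MeasurableSet (K : Set G))
    (h1 : μ (K : Set G) = 1) (T S : heckeAlgebra ℂ K) (v : invariants ρ K) :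
    ∫ x, haarConv μ
        (fun y => ((S : Module.End ℂ (MonoidAlgebra ℂ (G ⧸ K)))
          (MonoidAlgebra.single ((1 : G) : G ⧸ K) 1)).coeff (y : G ⧸ K))
        (fun y => ((T : Module.End ℂ (MonoidAlgebra ℂ (G ⧸ K)))
          (MonoidAlgebra.single ((1 : G) : G ⧸ K) 1)).coeff (y : G ⧸ K)) x • ρ x (v : E) ∂μ =
      (heckeSMul ρ S (heckeSMul ρ T v) : E) := by
  have h : (fun x : G => haarConv μ
        (fun y => ((S : Module.End ℂ (MonoidAlgebra ℂ (G ⧸ K)))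
          (MonoidAlgebra.single ((1 : G) : G ⧸ K) 1)).coeff (y : G ⧸ K))
        (fun y => ((T : Module.End ℂ (MonoidAlgebra ℂ (G ⧸ K)))
          (MonoidAlgebra.single ((1 : G) : G ⧸ K) 1)).coeff (y : G ⧸ K)) x • ρ x (v : E)) =
      fun x : G => (((T * S : heckeAlgebra ℂ K) : Module.End ℂ (MonoidAlgebra ℂ (G ⧸ K)))
        (MonoidAlgebra.single ((1 : G) : G ⧸ K) 1)).coeff (x : G ⧸ K) • ρ x (v : E) := by
    funext x
    rw [haarConv_apply_single_one μ hKm h1 T S x]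
  rw [h, integral_apply_single_one_smul_of_measure_eq_one μ ρ hKm h1 (T * S) v, heckeSMul_mul]

/-- The same identity, the right-hand side written as the action of the product `T S`
(`heckeSMul_mul`: the Hecke action is a right action, `(T S) • v = S • (T • v)`). -/
theorem integral_haarConv_smul_of_measure_eq_one' (hKm : MeasurableSet (K : Set G))
    (h1 : μ (K : Set G) = 1) (T S : heckeAlgebra ℂ K) (v : invariants ρ K) :
    ∫ x, haarConv μ
        (fun y => ((S : Module.End ℂ (MonoidAlgebra ℂ (G ⧸ K)))
          (MonoidAlgebra.single ((1 : G) : G ⧸ K) 1)).coeff (y : G ⧸ K))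
        (fun y => ((T : Module.End ℂ (MonoidAlgebra ℂ (G ⧸ K)))
          (MonoidAlgebra.single ((1 : G) : G ⧸ K) 1)).coeff (y : G ⧸ K)) x • ρ x (v : E) ∂μ =
      (heckeSMul ρ (T * S) v : E) := by
  rw [integral_haarConv_smul_of_measure_eq_one μ ρ hKm h1 T S v, heckeSMul_mul]

/-- The double-coset case recovered: `f_{T_g} = 1_{KgK}` gives back
`T5HaarHeckeAction.integral_indicator_doubleCosetSet_smul_eq_heckeSMul`. -/
theorem integral_indicator_doubleCosetSet_smul_eq_heckeSMul' (hKm : MeasurableSet (K : Set G))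
    (hKfin : μ (K : Set G) ≠ ⊤) (g : G) [Finite (MulAction.orbit K ((g : G) : G ⧸ K))]
    (v : invariants ρ K) :
    ∫ y, (T5HaarDoubleCosetVolume.doubleCosetSet K g).indicator (fun _ => (1 : ℝ)) y • ρ y (v : E) ∂μ =
      μ.real (K : Set G) • (heckeSMul ρ (T5HeckeDoubleCoset.doubleCosetOp ℂ K g) v : E) :=
  integral_indicator_doubleCosetSet_smul_eq_heckeSMul μ ρ hKm hKfin g v

end Summit.Ventures.HodgeRepro2.T5HaarHeckeActionGeneral
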